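import Mathlib
import Summits.MatrixMultiplication.MatrixMultiplication.Theses.AutomaticSTPPDesigns
import Summits.MatrixMultiplication.MatrixMultiplication.Theorems.AutomaticSTPPDesignsAutomaticDesignBelowFourFifthsTransfer
import Literature.Combinatorics.Additive.TripleProductProperty
import Literature.Computability.AlgebraicComplexity.GroupTheoreticMatMul

/-!
# Skeleton — crux `AutomaticDesignBelowFourFifths` (stmt-MatrixMultiplication-7357), line `Sketch`

Composition (extension-product collapse, idea card `extension-product-collapse`):

  `stub_cyclicDesignBelowFourFifths` (C⁺: ONE finite STPP family in some `ℤ/N`, `N ≥ 2`, with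
  `N < ∑ᵢ (|Aᵢ||Bᵢ||Cᵢ|)^{4/5}`)
  → `AutomaticDesignBelowFourFifths` by the LANDED transfer
  `AutomaticDesignBelowFourFifths.stub_transfer` (= `crux_of_cyclicDesign`, p103493/p104643:
  base `p := N`, letterwise languages of the digit sets, carry induction, multiplicative packing sum).

The converse `AutomaticDesignBelowFourFifths.cyclicDesign_of_crux` (same landed file) shows C⁺ is
EQUIVALENT to the crux, so the line has exactly one open stub and it is crux-sized: a finite cyclic
STPP design certifying `ω ≤ 2.4` through CKSU Thm 5.5.
-/

set_option linter.dupNamespace false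

noncomputable section

namespace Summit.MatrixMultiplication.MatrixMultiplication.Theorems

namespace AutomaticDesignBelowFourFifthsSkeleton

open Finset Literature.Combinatorics.Additive

/-- **Stub C⁺ (the crux in normal form).** A finite STPP family in a cyclic group `ℤ/N`, `N ≥ 2`,
whose packing sum at exponent `4/5` exceeds `N`. OPEN (hardest stub; held by the lead). -/
theorem stub_cyclicDesignBelowFourFifths :
    ∃ (N n : ℕ), 2 ≤ N ∧ ∃ A B C : Fin n → Finset (ZMod N),
      Literature.Computability.AlgebraicComplexity.IsSTPP A B C ∧
      (N : ℝ) < ∑ i, (((A i).card * (B i).card * (C i).card : ℕ) : ℝ) ^ ((4 : ℝ) / 5) := by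
  sorry

/-- **Composition.** The crux from the one open stub and the landed transfer. -/
theorem AutomaticDesignBelowFourFifths_of :
    Summit.MatrixMultiplication.MatrixMultiplication.Theses.AutomaticSTPPDesigns.AutomaticDesignBelowFourFifths :=
  AutomaticDesignBelowFourFifths.stub_transfer stub_cyclicDesignBelowFourFifths

end AutomaticDesignBelowFourFifthsSkeleton

end Summit.MatrixMultiplication.MatrixMultiplication.Theorems
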